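import Summits.CriticalPhenomena.SAWScalingLimit.Theorems.SAWReversalUpgradeAttachReversalReversalA

/-!
# Attachment reversal: exact time reversal, part B (crossing parameters and cut times, by cases)

Helper file for item `AttachReversal` of route `SAWReversalUpgrade` (stmt-CriticalPhenomena-18007).
Setting of part A (`(D; a, b)`, `φ`, `φ' = φ ∘ ι_c`, `Φ`, `Φ'`, `0 < e ≤ 1/2`, `U` continuous with
values in `closure D` and endpoints `U 0, U 1 ∉ {a, b}`, `U' u = U (1 - u)`), with the trimmed
interval `[i, j]` nonempty. The crossing parameters and cut times of the primed data (computed in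
`D.swap` from `U'`) are expressed through the unprimed ones:

* `exit_spec` / `access_spec` — when `U j ≠ b` (resp. `U i ≠ a`) the exit parameter `r` (resp. the
  access parameter `s`) is attained: `Φ (r q) ∈ M`, `r` is the largest such parameter (resp.
  `Φ (s p) ∈ M`, `0 < s`, `s` is the smallest);
* `rev_sAcc_of_ne` — `U j ≠ b`: `s' = r⁻¹`, `p' = ι q`, and the primed access crossing is the
  unprimed exit crossing, `Φ' (s' p') = Φ (r q)`;
* `rev_rEx_of_ne` — `U i ≠ a`: `r' = s⁻¹`, `q' = ι p`, `Φ' (r' q') = Φ (s p)`.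

(The degenerate ends `U j = b`, `U i = a` are in part B'.)
-/

noncomputable section

open Set Function Filter Topology Complex
open UpperHalfPlane (upperHalfPlaneSet)
open Literature.Probability.RandomPlanarGeometry

namespace Summit.CriticalPhenomena.SAWScalingLimit.Theorems.AttachReversal

variable {D : DobrushinDomain} {φ : ConformalEquiv upperHalfPlaneSet D.carrier}
  {φ' : ConformalEquiv upperHalfPlaneSet D.swap.carrier} {c e : ℝ} {U : ℝ → ℂ}

/-! ### The exit parameter is attained (case `U j ≠ b`) -/

/-- **The exit crossing parameter is attained** when the trimmed interval is nonempty and does not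
end at `b`: `1 ≤ r`, `Φ (r q) ∈ M`, every `ρ ≥ 1` with `Φ (ρ q) ∈ M` is `≤ r`, and `q ∈ ℍ`. -/
theorem exit_spec (hφ : D.IsChordalUniformizing φ) (he : 0 < e) (he' : e ≤ 1 / 2) (hU : Continuous U)
    (hcl : ∀ s, U s ∈ closure D.carrier) (h1a : U 1 ≠ D.pt 0)
    (hij : lastA (D.pt 0) U ≤ firstB (D.pt 1) U) (hjb : U (firstB (D.pt 1) U) ≠ D.pt 1) :
    1 ≤ rEx (D.pt 0) (D.pt 1) φ.boundaryExtension e U ∧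
    φ.boundaryExtension ((rEx (D.pt 0) (D.pt 1) φ.boundaryExtension e U : ℂ) *
        qEx (D.pt 1) φ.boundaryExtension e U) ∈ midSet (D.pt 0) (D.pt 1) φ.boundaryExtension e U ∧
    (∀ ρ : ℝ, 1 ≤ ρ → φ.boundaryExtension ((ρ : ℂ) * qEx (D.pt 1) φ.boundaryExtension e U) ∈
        midSet (D.pt 0) (D.pt 1) φ.boundaryExtension e U → ρ ≤ rEx (D.pt 0) (D.pt 1) φ.boundaryExtension e U) ∧
    0 < (qEx (D.pt 1) φ.boundaryExtension e U).im := by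
  have hj1 : firstB (D.pt 1) U = 1 := firstB_eq_one_of_ne hU hjb
  have hja : U (firstB (D.pt 1) U) ≠ D.pt 0 := by rw [hj1]; exact h1a
  have hq : 0 < (qEx (D.pt 1) φ.boundaryExtension e U).im :=
    squeeze_hinv_im_pos hφ he he' (hcl _) hja hjb
  have hq0 : qEx (D.pt 1) φ.boundaryExtension e U ≠ 0 := by intro h; rw [h] at hq; simp at hq
  have hMc : IsClosed (midSet (D.pt 0) (D.pt 1) φ.boundaryExtension e U) :=
    (isCompact_midSet hφ he he' hU hcl).isClosed
  have hbM : D.pt 1 ∉ midSet (D.pt 0) (D.pt 1) φ.boundaryExtension e U := fun h =>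
    hjb ((pt_one_mem_midSet_iff hφ he he' hcl).1 h).2
  -- the set behind `rEx`, without its (true) guard
  have hSeq : {r : ℝ | 1 ≤ r ∧ U (firstB (D.pt 1) U) ≠ D.pt 1 ∧
      φ.boundaryExtension ((r : ℂ) * qEx (D.pt 1) φ.boundaryExtension e U) ∈
        midSet (D.pt 0) (D.pt 1) φ.boundaryExtension e U} =
      Ici 1 ∩ (fun r : ℝ => φ.boundaryExtension ((r : ℂ) * qEx (D.pt 1) φ.boundaryExtension e U)) ⁻¹'
        midSet (D.pt 0) (D.pt 1) φ.boundaryExtension e U := by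
    ext r
    simp only [mem_setOf_eq, mem_inter_iff, mem_Ici, mem_preimage]
    exact ⟨fun h => ⟨h.1, h.2.2⟩, fun h => ⟨h.1, hjb, h.2⟩⟩
  have h1S : (1:ℝ) ∈ Ici (1:ℝ) ∩ (fun r : ℝ => φ.boundaryExtension ((r : ℂ) *
      qEx (D.pt 1) φ.boundaryExtension e U)) ⁻¹' midSet (D.pt 0) (D.pt 1) φ.boundaryExtension e U := by
    refine ⟨self_mem_Ici, ?_⟩
    rw [mem_preimage, Complex.ofReal_one, one_mul, ← attZ_firstB_of_ne hjb]
    exact mem_image_of_mem _ ⟨hij, le_rfl⟩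
  have hSbdd : BddAbove (Ici (1:ℝ) ∩ (fun r : ℝ => φ.boundaryExtension ((r : ℂ) *
      qEx (D.pt 1) φ.boundaryExtension e U)) ⁻¹' midSet (D.pt 0) (D.pt 1) φ.boundaryExtension e U) := by
    have hev : ∀ᶠ r : ℝ in atTop, φ.boundaryExtension ((r : ℂ) * qEx (D.pt 1) φ.boundaryExtension e U) ∈
        (midSet (D.pt 0) (D.pt 1) φ.boundaryExtension e U)ᶜ :=
      tendsto_ray_pt_one hφ hq.le hq0 (hMc.isOpen_compl.mem_nhds hbM)
    obtain ⟨R₀, hR₀⟩ := eventually_atTop.1 hev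
    refine ⟨R₀, fun r hr => ?_⟩
    by_contra hlt
    exact hR₀ r (not_le.1 hlt).le hr.2
  have hScl : IsClosed (Ici (1:ℝ) ∩ (fun r : ℝ => φ.boundaryExtension ((r : ℂ) *
      qEx (D.pt 1) φ.boundaryExtension e U)) ⁻¹' midSet (D.pt 0) (D.pt 1) φ.boundaryExtension e U) :=
    ((continuousOn_ray φ hq.le).mono (Ici_subset_Ici.2 zero_le_one)).preimage_isClosed_of_isClosed
      isClosed_Ici hMc
  have hr : rEx (D.pt 0) (D.pt 1) φ.boundaryExtension e U = sSup (Ici (1:ℝ) ∩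
      (fun r : ℝ => φ.boundaryExtension ((r : ℂ) * qEx (D.pt 1) φ.boundaryExtension e U)) ⁻¹'
        midSet (D.pt 0) (D.pt 1) φ.boundaryExtension e U) := by
    unfold rEx
    rw [hSeq, union_eq_self_of_subset_left (singleton_subset_iff.2 h1S)]
  have hrS := hScl.csSup_mem ⟨1, h1S⟩ hSbdd
  rw [← hr] at hrS
  refine ⟨hrS.1, hrS.2, fun ρ hρ hρM => ?_, hq⟩
  rw [hr]
  exact le_csSup hSbdd ⟨hρ, hρM⟩

/-! ### The access parameter is attained (case `U i ≠ a`) -/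

/-- **The access crossing parameter is attained** when the trimmed interval is nonempty and does not
start at `a`: `s ∈ (0, 1]`, `Φ (s p) ∈ M`, every `σ ∈ (0, 1]` with `Φ (σ p) ∈ M` is `≥ s`, `p ∈ ℍ`. -/
theorem access_spec (hφ : D.IsChordalUniformizing φ) (he : 0 < e) (he' : e ≤ 1 / 2) (hU : Continuous U)
    (hcl : ∀ s, U s ∈ closure D.carrier) (h0b : U 0 ≠ D.pt 1)
    (hij : lastA (D.pt 0) U ≤ firstB (D.pt 1) U) (hia : U (lastA (D.pt 0) U) ≠ D.pt 0) :
    sAcc (D.pt 0) (D.pt 1) φ.boundaryExtension e U ∈ Ioc (0:ℝ) 1 ∧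
    φ.boundaryExtension ((sAcc (D.pt 0) (D.pt 1) φ.boundaryExtension e U : ℂ) *
        pAcc (D.pt 0) φ.boundaryExtension e U) ∈ midSet (D.pt 0) (D.pt 1) φ.boundaryExtension e U ∧
    (∀ σ : ℝ, σ ∈ Ioc (0:ℝ) 1 → φ.boundaryExtension ((σ : ℂ) * pAcc (D.pt 0) φ.boundaryExtension e U) ∈
        midSet (D.pt 0) (D.pt 1) φ.boundaryExtension e U → sAcc (D.pt 0) (D.pt 1) φ.boundaryExtension e U ≤ σ) ∧
    0 < (pAcc (D.pt 0) φ.boundaryExtension e U).im := by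
  have hi0 : lastA (D.pt 0) U = 0 := lastA_eq_zero_of_ne hU hia
  have hib : U (lastA (D.pt 0) U) ≠ D.pt 1 := by rw [hi0]; exact h0b
  have hp : 0 < (pAcc (D.pt 0) φ.boundaryExtension e U).im :=
    squeeze_hinv_im_pos hφ he he' (hcl _) hia hib
  have hMc : IsClosed (midSet (D.pt 0) (D.pt 1) φ.boundaryExtension e U) :=
    (isCompact_midSet hφ he he' hU hcl).isClosed
  have haM : D.pt 0 ∉ midSet (D.pt 0) (D.pt 1) φ.boundaryExtension e U := fun h =>
    hia ((pt_zero_mem_midSet_iff hφ he he' hcl).1 h).2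
  -- abbreviate the ray map and the set behind `sAcc`
  obtain ⟨f, hf⟩ : ∃ f : ℝ → ℂ, f = fun s : ℝ => φ.boundaryExtension ((s : ℂ) * pAcc (D.pt 0) φ.boundaryExtension e U) :=
    ⟨_, rfl⟩
  obtain ⟨S, hS⟩ : ∃ S : Set ℝ, S = {s : ℝ | s ∈ Ioc (0:ℝ) 1 ∧
      φ.boundaryExtension ((s : ℂ) * pAcc (D.pt 0) φ.boundaryExtension e U) ∈
        midSet (D.pt 0) (D.pt 1) φ.boundaryExtension e U} := ⟨_, rfl⟩
  have hs_def : sAcc (D.pt 0) (D.pt 1) φ.boundaryExtension e U = sInf S := by rw [hS]; rfl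
  have h1S : (1:ℝ) ∈ S := by
    rw [hS]
    refine ⟨⟨zero_lt_one, le_rfl⟩, ?_⟩
    rw [Complex.ofReal_one, one_mul, ← attZ_lastA_of_ne hib]
    exact mem_image_of_mem _ ⟨le_rfl, hij⟩
  -- near `s = 0` the ray is off `M`
  obtain ⟨s₀, hs₀, hs₀M⟩ : ∃ s₀ : ℝ, 0 < s₀ ∧ ∀ s, 0 ≤ s → s < s₀ → f s ∉
      midSet (D.pt 0) (D.pt 1) φ.boundaryExtension e U := by
    have hev : ∀ᶠ s : ℝ in 𝓝[≥] 0, f s ∈ (midSet (D.pt 0) (D.pt 1) φ.boundaryExtension e U)ᶜ := by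
      rw [hf]; exact tendsto_ray_pt_zero hφ hp.le (hMc.isOpen_compl.mem_nhds haM)
    obtain ⟨u, hu, hsub⟩ := mem_nhdsGE_iff_exists_Ico_subset.1 hev
    exact ⟨u, hu, fun s hs hsu => hsub ⟨hs, hsu⟩⟩
  have hSsub : S ⊆ Icc s₀ 1 := by
    rw [hS]; intro s hs
    refine ⟨not_lt.1 fun h => hs₀M s hs.1.1.le h ?_, hs.1.2⟩
    rw [hf]; exact hs.2
  have hSeq : S = Icc s₀ 1 ∩ f ⁻¹' midSet (D.pt 0) (D.pt 1) φ.boundaryExtension e U := by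
    ext s
    constructor
    · intro hs; refine ⟨hSsub hs, ?_⟩; rw [hS] at hs; rw [mem_preimage, hf]; exact hs.2
    · rintro ⟨hs, hsM⟩; rw [hS]; rw [mem_preimage, hf] at hsM; exact ⟨⟨hs₀.trans_le hs.1, hs.2⟩, hsM⟩
  have hScl : IsClosed S := by
    rw [hSeq]
    refine ContinuousOn.preimage_isClosed_of_isClosed ?_ isClosed_Icc hMc
    rw [hf]
    exact (continuousOn_ray φ hp.le).mono fun s hs => hs₀.le.trans hs.1
  have hSbdd : BddBelow S := ⟨s₀, fun s hs => (hSsub hs).1⟩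
  have hsS : sAcc (D.pt 0) (D.pt 1) φ.boundaryExtension e U ∈ S := by
    rw [hs_def]; exact hScl.csInf_mem ⟨1, h1S⟩ hSbdd
  have hsS' := hsS
  rw [hS] at hsS'
  refine ⟨hsS'.1, hsS'.2, fun σ hσ hσM => ?_, hp⟩
  rw [hs_def]
  refine csInf_le hSbdd ?_
  rw [hS]; exact ⟨hσ, hσM⟩

/-! ### The primed access data is the unprimed exit data (case `U j ≠ b`) -/

/-- **`s' = r⁻¹`, `p' = ι q`, `Φ' (s' p') = Φ (r q)`** when `U j ≠ b`. -/
theorem rev_sAcc_of_ne (hφ : D.IsChordalUniformizing φ) (hφ' : D.swap.IsChordalUniformizing φ')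
    (hc : 0 < c) (heq : ∀ z ∈ upperHalfPlaneSet, φ' z = φ (-((c : ℂ) * z)⁻¹)) (he : 0 < e)
    (he' : e ≤ 1 / 2) (hU : Continuous U) (hcl : ∀ s, U s ∈ closure D.carrier) (h1a : U 1 ≠ D.pt 0)
    (hij : lastA (D.pt 0) U ≤ firstB (D.pt 1) U) (hjb : U (firstB (D.pt 1) U) ≠ D.pt 1) :
    pAcc (D.pt 1) φ'.boundaryExtension e (fun u => U (1 - u)) =
        -((c : ℂ) * qEx (D.pt 1) φ.boundaryExtension e U)⁻¹ ∧
    sAcc (D.pt 1) (D.pt 0) φ'.boundaryExtension e (fun u => U (1 - u)) =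
        (rEx (D.pt 0) (D.pt 1) φ.boundaryExtension e U)⁻¹ ∧
    φ'.boundaryExtension ((sAcc (D.pt 1) (D.pt 0) φ'.boundaryExtension e (fun u => U (1 - u)) : ℂ) *
        pAcc (D.pt 1) φ'.boundaryExtension e (fun u => U (1 - u))) =
      φ.boundaryExtension ((rEx (D.pt 0) (D.pt 1) φ.boundaryExtension e U : ℂ) *
        qEx (D.pt 1) φ.boundaryExtension e U) := by
  obtain ⟨hr1, hrM, hrmax, hq⟩ := exit_spec hφ he he' hU hcl h1a hij hjb
  -- abbreviations
  obtain ⟨q, hq_def⟩ : ∃ q : ℂ, q = qEx (D.pt 1) φ.boundaryExtension e U := ⟨_, rfl⟩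
  obtain ⟨r, hr_def⟩ : ∃ r : ℝ, r = rEx (D.pt 0) (D.pt 1) φ.boundaryExtension e U := ⟨_, rfl⟩
  obtain ⟨M, hM_def⟩ : ∃ M : Set ℂ, M = midSet (D.pt 0) (D.pt 1) φ.boundaryExtension e U := ⟨_, rfl⟩
  rw [← hq_def] at hq hrM hrmax ⊢
  rw [← hr_def] at hr1 hrM hrmax ⊢
  rw [← hM_def] at hrM hrmax
  have hr0 : 0 < r := zero_lt_one.trans_le hr1
  have hj1 : firstB (D.pt 1) U = 1 := firstB_eq_one_of_ne hU hjb
  have hja : U (firstB (D.pt 1) U) ≠ D.pt 0 := by rw [hj1]; exact h1a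
  -- `p' = ι q`
  have hp' : pAcc (D.pt 1) φ'.boundaryExtension e (fun u => U (1 - u)) = -((c : ℂ) * q)⁻¹ := by
    rw [rev_pAcc, hinv_apply, invFunOn_bExt_swap_eq hφ hc heq (hcl _) hja hjb,
      squeeze_negInv e hc (FaithfulAttach.invFun_spec hφ (hcl _) hjb).1
        (invFunOn_bExt_ne_zero hφ (hcl _) hjb hja), hq_def]
    rfl
  -- the ray identity
  have hray : ∀ {s : ℝ}, 0 < s →
      φ'.boundaryExtension ((s : ℂ) * -((c : ℂ) * q)⁻¹) = φ.boundaryExtension (((s⁻¹ : ℝ) : ℂ) * q) :=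
    fun hs => bExt_swap_ray hc heq hq hs
  have hM' : midSet (D.pt 1) (D.pt 0) φ'.boundaryExtension e (fun u => U (1 - u)) = M := by
    rw [hM_def]; exact rev_midSet hφ hφ' hc heq he he' hcl
  -- the exit set `S` and the primed access set `S⁻¹`
  obtain ⟨S, hS⟩ : ∃ S : Set ℝ, S = {ρ : ℝ | 1 ≤ ρ ∧ φ.boundaryExtension ((ρ : ℂ) * q) ∈ M} := ⟨_, rfl⟩
  have hSet : {s : ℝ | s ∈ Ioc (0:ℝ) 1 ∧ φ'.boundaryExtension ((s : ℂ) *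
      pAcc (D.pt 1) φ'.boundaryExtension e (fun u => U (1 - u))) ∈
        midSet (D.pt 1) (D.pt 0) φ'.boundaryExtension e (fun u => U (1 - u))} = Inv.inv '' S := by
    rw [image_inv_eq_inv, hM', hp', hS]
    ext s
    rw [Set.mem_inv]
    simp only [mem_setOf_eq, mem_Ioc]
    constructor
    · rintro ⟨⟨hs0, hs1⟩, hsM⟩
      refine ⟨(one_le_inv₀ hs0).2 hs1, ?_⟩
      rwa [hray hs0] at hsM
    · rintro ⟨h1, hsM⟩
      have hs0 : 0 < s := by
        by_contra h
        have : s⁻¹ ≤ 0 := inv_nonpos.2 (not_lt.1 h)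
        linarith
      refine ⟨⟨hs0, (one_le_inv₀ hs0).1 h1⟩, ?_⟩
      rwa [hray hs0]
  have hrsup : r = sSup S := by
    have hSeq : {ρ : ℝ | 1 ≤ ρ ∧ U (firstB (D.pt 1) U) ≠ D.pt 1 ∧
        φ.boundaryExtension ((ρ : ℂ) * qEx (D.pt 1) φ.boundaryExtension e U) ∈
          midSet (D.pt 0) (D.pt 1) φ.boundaryExtension e U} = S := by
      rw [hS, ← hq_def, ← hM_def]
      ext ρ; simp only [mem_setOf_eq]; exact ⟨fun h => ⟨h.1, h.2.2⟩, fun h => ⟨h.1, hjb, h.2⟩⟩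
    have h1 : (1:ℝ) ∈ S := by
      rw [hS]
      refine ⟨le_rfl, ?_⟩
      rw [Complex.ofReal_one, one_mul, hq_def, hM_def, ← attZ_firstB_of_ne hjb]
      exact mem_image_of_mem _ ⟨hij, le_rfl⟩
    rw [hr_def]
    unfold rEx
    rw [hSeq, union_eq_self_of_subset_left (singleton_subset_iff.2 h1)]
  have hSbdd : BddAbove S := ⟨r, fun ρ hρ => by rw [hS] at hρ; exact hrmax ρ hρ.1 hρ.2⟩
  have hSne : S.Nonempty := ⟨r, by rw [hS]; exact ⟨hr1, hrM⟩⟩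
  have hs' : sAcc (D.pt 1) (D.pt 0) φ'.boundaryExtension e (fun u => U (1 - u)) = r⁻¹ := by
    show sInf {s : ℝ | s ∈ Ioc (0:ℝ) 1 ∧ φ'.boundaryExtension ((s : ℂ) *
      pAcc (D.pt 1) φ'.boundaryExtension e (fun u => U (1 - u))) ∈
        midSet (D.pt 1) (D.pt 0) φ'.boundaryExtension e (fun u => U (1 - u))} = r⁻¹
    rw [hSet]
    have hanti : AntitoneOn (fun x : ℝ => x⁻¹) S :=
      inv_antitoneOn_Ioi.mono fun ρ hρ => by rw [hS] at hρ; exact zero_lt_one.trans_le hρ.1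
    have hcont : ContinuousWithinAt (fun x : ℝ => x⁻¹) S (sSup S) := by
      rw [← hrsup]; exact (continuousAt_inv₀ hr0.ne').continuousWithinAt
    have h := hanti.map_csSup_of_continuousWithinAt hcont hSne hSbdd
    rw [← hrsup] at h
    exact h.symm
  refine ⟨hp', hs', ?_⟩
  rw [hs', hp', hray (inv_pos.2 hr0), inv_inv]

/-! ### The primed exit data is the unprimed access data (case `U i ≠ a`) -/

/-- **`r' = s⁻¹`, `q' = ι p`, `Φ' (r' q') = Φ (s p)`** when `U i ≠ a`. -/
theorem rev_rEx_of_ne (hφ : D.IsChordalUniformizing φ) (hφ' : D.swap.IsChordalUniformizing φ')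
    (hc : 0 < c) (heq : ∀ z ∈ upperHalfPlaneSet, φ' z = φ (-((c : ℂ) * z)⁻¹)) (he : 0 < e)
    (he' : e ≤ 1 / 2) (hU : Continuous U) (hcl : ∀ s, U s ∈ closure D.carrier) (h0b : U 0 ≠ D.pt 1)
    (hij : lastA (D.pt 0) U ≤ firstB (D.pt 1) U) (hia : U (lastA (D.pt 0) U) ≠ D.pt 0) :
    qEx (D.pt 0) φ'.boundaryExtension e (fun u => U (1 - u)) =
        -((c : ℂ) * pAcc (D.pt 0) φ.boundaryExtension e U)⁻¹ ∧
    rEx (D.pt 1) (D.pt 0) φ'.boundaryExtension e (fun u => U (1 - u)) =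
        (sAcc (D.pt 0) (D.pt 1) φ.boundaryExtension e U)⁻¹ ∧
    φ'.boundaryExtension ((rEx (D.pt 1) (D.pt 0) φ'.boundaryExtension e (fun u => U (1 - u)) : ℂ) *
        qEx (D.pt 0) φ'.boundaryExtension e (fun u => U (1 - u))) =
      φ.boundaryExtension ((sAcc (D.pt 0) (D.pt 1) φ.boundaryExtension e U : ℂ) *
        pAcc (D.pt 0) φ.boundaryExtension e U) := by
  obtain ⟨hs01, hsM, hsmin, hp⟩ := access_spec hφ he he' hU hcl h0b hij hia
  obtain ⟨p, hp_def⟩ : ∃ p : ℂ, p = pAcc (D.pt 0) φ.boundaryExtension e U := ⟨_, rfl⟩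
  obtain ⟨s, hs_def⟩ : ∃ s : ℝ, s = sAcc (D.pt 0) (D.pt 1) φ.boundaryExtension e U := ⟨_, rfl⟩
  obtain ⟨M, hM_def⟩ : ∃ M : Set ℂ, M = midSet (D.pt 0) (D.pt 1) φ.boundaryExtension e U := ⟨_, rfl⟩
  rw [← hp_def] at hp hsM hsmin ⊢
  rw [← hs_def] at hs01 hsM hsmin ⊢
  rw [← hM_def] at hsM hsmin
  have hi0 : lastA (D.pt 0) U = 0 := lastA_eq_zero_of_ne hU hia
  have hib : U (lastA (D.pt 0) U) ≠ D.pt 1 := by rw [hi0]; exact h0b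
  -- `q' = ι p`
  have hq' : qEx (D.pt 0) φ'.boundaryExtension e (fun u => U (1 - u)) = -((c : ℂ) * p)⁻¹ := by
    rw [rev_qEx, hinv_apply, invFunOn_bExt_swap_eq hφ hc heq (hcl _) hia hib,
      squeeze_negInv e hc (FaithfulAttach.invFun_spec hφ (hcl _) hib).1
        (invFunOn_bExt_ne_zero hφ (hcl _) hib hia), hp_def]
    rfl
  have hray : ∀ {ρ : ℝ}, 0 < ρ →
      φ'.boundaryExtension ((ρ : ℂ) * -((c : ℂ) * p)⁻¹) = φ.boundaryExtension (((ρ⁻¹ : ℝ) : ℂ) * p) :=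
    fun hρ => bExt_swap_ray hc heq hp hρ
  have hguard : U (1 - firstB (D.pt 0) fun u => U (1 - u)) ≠ D.pt 0 := by
    show (fun u => U (1 - u)) (firstB (D.pt 0) fun u => U (1 - u)) ≠ D.pt 0
    rw [rev_guard]; exact hia
  have hM' : midSet (D.pt 1) (D.pt 0) φ'.boundaryExtension e (fun u => U (1 - u)) = M := by
    rw [hM_def]; exact rev_midSet hφ hφ' hc heq he he' hcl
  obtain ⟨S, hS⟩ : ∃ S : Set ℝ, S = {σ : ℝ | σ ∈ Ioc (0:ℝ) 1 ∧ φ.boundaryExtension ((σ : ℂ) * p) ∈ M} :=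
    ⟨_, rfl⟩
  have hSet : {ρ : ℝ | 1 ≤ ρ ∧ (fun u => U (1 - u)) (firstB (D.pt 0) fun u => U (1 - u)) ≠ D.pt 0 ∧
      φ'.boundaryExtension ((ρ : ℂ) * qEx (D.pt 0) φ'.boundaryExtension e (fun u => U (1 - u))) ∈
        midSet (D.pt 1) (D.pt 0) φ'.boundaryExtension e (fun u => U (1 - u))} = Inv.inv '' S := by
    rw [image_inv_eq_inv, hM', hq', hS]
    ext ρ
    rw [Set.mem_inv]
    simp only [mem_setOf_eq, mem_Ioc]
    constructor
    · rintro ⟨h1, -, hρM⟩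
      have hρ0 : 0 < ρ := zero_lt_one.trans_le h1
      refine ⟨⟨inv_pos.2 hρ0, (inv_le_one₀ hρ0).2 h1⟩, ?_⟩
      rwa [hray hρ0] at hρM
    · rintro ⟨⟨h0, h1⟩, hρM⟩
      have hρ0 : 0 < ρ := inv_pos.1 h0
      refine ⟨(inv_le_one₀ hρ0).1 h1, hguard, ?_⟩
      rwa [hray hρ0]
  have hSbdd : BddBelow S := ⟨s, fun σ hσ => by rw [hS] at hσ; exact hsmin σ hσ.1 hσ.2⟩
  have hSne : S.Nonempty := ⟨s, by rw [hS]; exact ⟨hs01, hsM⟩⟩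
  have hssup : s = sInf S := by rw [hs_def, hS, hp_def, hM_def]; rfl
  have hr' : rEx (D.pt 1) (D.pt 0) φ'.boundaryExtension e (fun u => U (1 - u)) = s⁻¹ := by
    show sSup ({(1:ℝ)} ∪ {ρ : ℝ | 1 ≤ ρ ∧ (fun u => U (1 - u)) (firstB (D.pt 0) fun u => U (1 - u)) ≠ D.pt 0 ∧
      φ'.boundaryExtension ((ρ : ℂ) * qEx (D.pt 0) φ'.boundaryExtension e (fun u => U (1 - u))) ∈
        midSet (D.pt 1) (D.pt 0) φ'.boundaryExtension e (fun u => U (1 - u))}) = s⁻¹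
    rw [hSet]
    have h1 : (1:ℝ) ∈ Inv.inv '' S := by
      rw [image_inv_eq_inv, Set.mem_inv, inv_one, hS]
      refine ⟨⟨zero_lt_one, le_rfl⟩, ?_⟩
      rw [Complex.ofReal_one, one_mul, hp_def, hM_def, ← attZ_lastA_of_ne hib]
      exact mem_image_of_mem _ ⟨le_rfl, hij⟩
    rw [union_eq_self_of_subset_left (singleton_subset_iff.2 h1)]
    have hanti : AntitoneOn (fun x : ℝ => x⁻¹) S :=
      inv_antitoneOn_Ioi.mono fun σ hσ => by rw [hS] at hσ; exact hσ.1.1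
    have hcont : ContinuousWithinAt (fun x : ℝ => x⁻¹) S (sInf S) := by
      rw [← hssup]; exact (continuousAt_inv₀ hs01.1.ne').continuousWithinAt
    have h := hanti.map_csInf_of_continuousWithinAt hcont hSne hSbdd
    rw [← hssup] at h
    exact h.symm
  refine ⟨hq', hr', ?_⟩
  rw [hr', hq', hray (inv_pos.2 hs01.1), inv_inv]
end Summit.CriticalPhenomena.SAWScalingLimit.Theorems.AttachReversal

end
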